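import Summits.Ventures.PercRepro.ProfileGapMonoThresholdLongLineCore

/-!
# PercRepro — THE LONG-LINE CASE OF THE CO-RANK-3 THRESHOLD FAMILY, II: THE COUNT
(p5, gen 29; `proofs/P5-GM1.md` §38; announced INBOX 13743)

On a simple coloop-free matroid with `ρ(E) ≥ 3` and `ν(E) ≥ 3`, the demanding sets with positive excess are the
proper spanning subsets `B` of long lines (`…LongLineCore`).  Each is sent to a set `D(B)` of the same line with
`3 ≤ #D ≤ #ℓ − 1` (`D(B) = B`, or `B` plus one more point of the line when `#B = 2`); a set `D` receives at most
`4` bad sets (itself and, when `#D = 3`, its three pairs), and its two sub-line targets `D ∪ {y₀}`, `D ∪ {y₁}` (two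
outside points) carry slack `≥ 2` each.  **`card_bad_long_le`**: the demanding bad sets number at most the slack
`Σ_{S∈T_t} (3 − d_t(S))`; with the per-set bound this is **`thresholdIneq_three_of_long`**: `ThresholdIneq N 3 t`
for every `t ≥ 2` on every simple coloop-free matroid with `ρ(E) ≥ 3` and `ν(E) ≥ 3`.
-/

open scoped Matroid

namespace PercRepro.Cogirth

open Finset ThmH Skew Shadow Profile

variable {α : Type} [DecidableEq α] {N : Matroid α} [N.Finite]

section Count

variable {t : ℕ}

/-- `cl D = cl B` for a spanning subset `D ⊆ cl B` (`#D ≥ 2`). -/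
theorem clF_eq_clF_of_subset_clF (hpair : ∀ x ∈ gr N, ∀ y ∈ gr N, x ≠ y → rk N {x, y} = 2)
    {B D : Finset α} (hB : B ∈ Rq N 2) (hD : D ⊆ clF N B) (hD2 : 2 ≤ D.card) : clF N D = clF N B := by
  have hBg := (mem_Rq.1 hB).1
  have hBrk : rk N B = 2 := rk_eq_of_eRk_eq_cq (mem_Rq.1 hB).2
  have hDg : D ⊆ gr N := hD.trans (clF_subset_gr B)
  apply Subset.antisymm (clF_subset_clF_of_subset_clF hBg hD)
  intro z hz
  have hzg : z ∈ gr N := clF_subset_gr B hz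
  rw [mem_clF_iff_rk_insert hzg hDg, rk_eq_two_of_subset_clF hpair hB hD hD2]
  have h1 : rk N (insert z D) ≤ rk N (clF N B) := rk_mono' (insert_subset hz hD)
  have h2 : rk N D ≤ rk N (insert z D) := rk_mono' (subset_insert _ _)
  rw [rk_clF, hBrk] at h1
  rw [rk_eq_two_of_subset_clF hpair hB hD hD2] at h2
  omega

/-- **The long-line count** (`ρ(E) ≥ 3`, `ν(E) ≥ 3`): the demanding bad sets (proper spanning subsets of long lines)
number at most the slack `Σ_{S∈T_t} (3 − d_t(S))`. -/
theorem card_bad_long_le (hpair : ∀ x ∈ gr N, ∀ y ∈ gr N, x ≠ y → rk N {x, y} = 2)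
    (hcf : ∀ z ∈ gr N, rk N ((gr N).erase z) = rk N (gr N)) (hR : 3 ≤ rk N (gr N))
    (hnu : rk N (gr N) + 3 ≤ (gr N).card) :
    (((Rq N 2).filter (fun B => t + 1 ≤ rk N (gr N \ B))).filter
      (fun B => (clF N B).card + rk N (gr N) = (gr N).card + 1 ∧ B ≠ clF N B)).card ≤
    ∑ S ∈ levelSetCoQ N t 3,
      (3 - ((coloops N S).filter
        (fun y => S.erase y ∈ (Rq N 2).filter (fun B => t + 1 ≤ rk N (gr N \ B)))).card) := by
  set L := (Rq N 2).filter (fun B => t + 1 ≤ rk N (gr N \ B)) with hL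
  set BP := L.filter (fun B => (clF N B).card + rk N (gr N) = (gr N).card + 1 ∧ B ≠ clF N B) with hBP
  set sl : Finset α → ℕ := fun S => 3 - ((coloops N S).filter (fun y => S.erase y ∈ L)).card with hsl
  have hmem : ∀ B ∈ BP, B ∈ Rq N 2 ∧ t + 1 ≤ rk N (gr N \ B) ∧
      ((clF N B).card + rk N (gr N) = (gr N).card + 1 ∧ B ≠ clF N B) := by
    intro B hB
    rw [hBP, mem_filter, hL, mem_filter] at hB
    exact ⟨hB.1.1, hB.1.2, hB.2⟩
  rcases BP.eq_empty_or_nonempty with hemp | ⟨B₀, hB₀⟩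
  · rw [hemp, card_empty]
    exact Nat.zero_le _
  have hB2 : ∀ B ∈ BP, 2 ≤ B.card := by
    intro B hB
    have := rk_le_card (M := N) B
    rw [rk_eq_of_eRk_eq_cq (mem_Rq.1 (hmem B hB).1).2] at this
    exact this
  obtain ⟨a₀, _⟩ : B₀.Nonempty := by
    rw [← card_pos]
    have := hB2 B₀ hB₀
    omega
  haveI : Inhabited α := ⟨a₀⟩
  let pick : Finset α → α := fun X => if h : X.Nonempty then h.choose else default
  have hpick : ∀ X : Finset α, X.Nonempty → pick X ∈ X := by
    intro X h
    simp only [pick, dif_pos h]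
    exact h.choose_spec
  -- the set `D(B)`
  let Dof : Finset α → Finset α := fun B => if 3 ≤ B.card then B else insert (pick (clF N B \ B)) B
  -- basic facts on a bad set
  have hBcl : ∀ B ∈ BP, B ⊆ clF N B := fun B hB => subset_clF (mem_Rq.1 (hmem B hB).1).1
  have hclcard : ∀ B ∈ BP, 4 ≤ (clF N B).card := by
    intro B hB
    have := (hmem B hB).2.2.1
    omega
  have hdiff : ∀ B ∈ BP, (clF N B \ B).Nonempty := by
    intro B hB
    rw [← card_pos, card_sdiff_of_subset (hBcl B hB)]
    have h1 := card_lt_card (Finset.ssubset_iff_subset_ne.2 ⟨hBcl B hB, (hmem B hB).2.2.2⟩)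
    omega
  have hDsub : ∀ B ∈ BP, Dof B ⊆ clF N B := by
    intro B hB
    simp only [Dof]
    split_ifs
    · exact hBcl B hB
    · exact insert_subset (mem_sdiff.1 (hpick _ (hdiff B hB))).1 (hBcl B hB)
  have hD3 : ∀ B ∈ BP, 3 ≤ (Dof B).card := by
    intro B hB
    simp only [Dof]
    split_ifs with h
    · exact h
    · rw [card_insert_of_notMem (mem_sdiff.1 (hpick _ (hdiff B hB))).2]
      have := hB2 B hB
      omega
  have hDlt : ∀ B ∈ BP, (Dof B).card < (clF N B).card := by
    intro B hB
    simp only [Dof]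
    split_ifs with h
    · exact card_lt_card (Finset.ssubset_iff_subset_ne.2 ⟨hBcl B hB, (hmem B hB).2.2.2⟩)
    · rw [card_insert_of_notMem (mem_sdiff.1 (hpick _ (hdiff B hB))).2]
      have := hclcard B hB
      have := hB2 B hB
      omega
  have hBsubD : ∀ B ∈ BP, B ⊆ Dof B := by
    intro B hB
    simp only [Dof]
    split_ifs
    · exact Subset.refl _
    · exact subset_insert _ _
  -- a point of the line outside `D(B)`
  have hpt : ∀ B ∈ BP, ∃ p ∈ clF N B, p ∉ Dof B := by
    intro B hB
    by_contra hall
    push Not at hall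
    have := card_le_card (show clF N B ⊆ Dof B from fun p hp => hall p hp)
    have := hDlt B hB
    omega
  -- the outside points of a set `D`
  let y₀ : Finset α → α := fun D => pick (gr N \ clF N D)
  let y₁ : Finset α → α := fun D => pick ((gr N \ clF N D).erase (y₀ D))
  have hclD : ∀ B ∈ BP, clF N (Dof B) = clF N B := fun B hB =>
    clF_eq_clF_of_subset_clF hpair (hmem B hB).1 (hDsub B hB) (by have := hD3 B hB; omega)
  have hout : ∀ B ∈ BP, y₀ (Dof B) ∈ gr N \ clF N B ∧ y₁ (Dof B) ∈ gr N \ clF N B ∧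
      y₁ (Dof B) ≠ y₀ (Dof B) := by
    intro B hB
    have hcard : (gr N \ clF N B).card = rk N (gr N) - 1 := by
      rw [card_sdiff_of_subset (clF_subset_gr B)]
      have := (hmem B hB).2.2.1
      have := card_le_card (clF_subset_gr (M := N) B)
      omega
    have hne : (gr N \ clF N B).Nonempty := by
      rw [← card_pos, hcard]
      omega
    have h0 : y₀ (Dof B) ∈ gr N \ clF N B := by
      have hne0 : (gr N \ clF N (Dof B)).Nonempty := by rw [hclD B hB]; exact hne
      have h : y₀ (Dof B) ∈ gr N \ clF N (Dof B) := hpick _ hne0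
      rw [hclD B hB] at h
      exact h
    have hne' : ((gr N \ clF N B).erase (y₀ (Dof B))).Nonempty := by
      rw [← card_pos, card_erase_of_mem h0, hcard]
      omega
    have h1 : y₁ (Dof B) ∈ (gr N \ clF N B).erase (y₀ (Dof B)) := by
      have hne1 : ((gr N \ clF N (Dof B)).erase (y₀ (Dof B))).Nonempty := by rw [hclD B hB]; exact hne'
      have h : y₁ (Dof B) ∈ (gr N \ clF N (Dof B)).erase (y₀ (Dof B)) := hpick _ hne1
      rw [hclD B hB] at h
      exact h
    exact ⟨h0, mem_of_mem_erase h1, (mem_erase.1 h1).1⟩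
  let tgt : Finset α → Finset (Finset α) := fun D => {insert (y₀ D) D, insert (y₁ D) D}
  -- the targets lie in `T_t`, with slack `≥ 2`, and are distinct
  have hT : ∀ B ∈ BP, ∀ y ∈ gr N \ clF N B, insert y (Dof B) ∈ levelSetCoQ N t 3 := by
    intro B hB y hy
    obtain ⟨p, hp, hpD⟩ := hpt B hB
    exact insert_mem_levelSetCoQ_three_of_long hpair hcf (hmem B hB).1 (hmem B hB).2.1 (hDsub B hB)
      (by have := hD3 B hB; omega) hp hpD hy
  have hslack : ∀ B ∈ BP, ∀ y ∈ gr N \ clF N B, 2 ≤ sl (insert y (Dof B)) := by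
    intro B hB y hy
    have hc := card_le_card (coloops_insert_subset_of_long hpair (hmem B hB).1 (hDsub B hB) (hD3 B hB) hy)
    rw [card_singleton] at hc
    have hf := card_le_card (filter_subset (fun z => (insert y (Dof B)).erase z ∈ L)
      (coloops N (insert y (Dof B))))
    simp only [hsl]
    omega
  have hdistinct : ∀ B ∈ BP, insert (y₀ (Dof B)) (Dof B) ≠ insert (y₁ (Dof B)) (Dof B) := by
    intro B hB h
    obtain ⟨h0, h1, hne⟩ := hout B hB
    exact hne (eq_of_insert_eq_of_subset_clF hpair (hmem B hB).1 (hmem B hB).1 (hDsub B hB) (hDsub B hB)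
      (hD3 B hB) (hD3 B hB) h0 h1 h).1.symm
  have hkey : ∀ B ∈ BP, ∀ B' ∈ BP, ∀ S ∈ tgt (Dof B), S ∈ tgt (Dof B') → Dof B = Dof B' := by
    intro B hB B' hB' S hS hS'
    have hx : ∃ x ∈ gr N \ clF N B, S = insert x (Dof B) := by
      rcases mem_insert.1 hS with h | h
      · exact ⟨_, (hout B hB).1, h⟩
      · exact ⟨_, (hout B hB).2.1, mem_singleton.1 h⟩
    have hx' : ∃ x' ∈ gr N \ clF N B', S = insert x' (Dof B') := by
      rcases mem_insert.1 hS' with h | h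
      · exact ⟨_, (hout B' hB').1, h⟩
      · exact ⟨_, (hout B' hB').2.1, mem_singleton.1 h⟩
    obtain ⟨x, hx, rfl⟩ := hx
    obtain ⟨x', hx', heq⟩ := hx'
    exact (eq_of_insert_eq_of_subset_clF hpair (hmem B hB).1 (hmem B' hB').1 (hDsub B hB) (hDsub B' hB')
      (hD3 B hB) (hD3 B' hB') hx hx' heq).2
  -- the fibre of a set `D`: at most `4` bad sets
  set BD := BP.image Dof with hBD
  have hfib : ∀ D ∈ BD, (BP.filter (fun B => Dof B = D)).card ≤ 4 := by
    intro D hD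
    obtain ⟨B₁, hB₁, rfl⟩ := mem_image.1 hD
    have hsubset : ∀ B ∈ BP, Dof B = Dof B₁ → B ⊆ Dof B₁ := fun B hB h => h ▸ hBsubD B hB
    by_cases h3 : (Dof B₁).card = 3
    · calc (BP.filter (fun B => Dof B = Dof B₁)).card
          ≤ (insert (Dof B₁) (powersetCard 2 (Dof B₁))).card := by
            apply card_le_card
            intro B hB
            rw [mem_filter] at hB
            rw [mem_insert, mem_powersetCard]
            by_cases hB3 : 3 ≤ B.card
            · left
              have : Dof B = B := by simp only [Dof, if_pos hB3]
              rw [← hB.2, this]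
            · right
              exact ⟨hsubset B hB.1 hB.2, by have := hB2 B hB.1; omega⟩
        _ ≤ (powersetCard 2 (Dof B₁)).card + 1 := card_insert_le _ _
        _ = 4 := by rw [card_powersetCard, h3]; rfl
    · calc (BP.filter (fun B => Dof B = Dof B₁)).card ≤ ({Dof B₁} : Finset (Finset α)).card := by
            apply card_le_card
            intro B hB
            rw [mem_filter] at hB
            rw [mem_singleton]
            by_cases hB3 : 3 ≤ B.card
            · have : Dof B = B := by simp only [Dof, if_pos hB3]
              rw [← hB.2, this]
            · exfalso
              apply h3
              rw [← hB.2]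
              simp only [Dof, if_neg hB3]
              rw [card_insert_of_notMem (mem_sdiff.1 (hpick _ (hdiff B hB.1))).2]
              have := hB2 B hB.1
              omega
        _ ≤ 4 := by rw [card_singleton]; norm_num
  have hdisj : (BD : Set (Finset α)).PairwiseDisjoint tgt := by
    intro D hD D' hD' hne
    rw [Finset.mem_coe] at hD hD'
    obtain ⟨B₁, hB₁, rfl⟩ := mem_image.1 hD
    obtain ⟨B₂, hB₂, rfl⟩ := mem_image.1 hD'
    rw [Function.onFun, Finset.disjoint_left]
    intro S hS hS'
    exact hne (hkey B₁ hB₁ B₂ hB₂ S hS hS')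
  calc BP.card = ∑ D ∈ BD, (BP.filter (fun B => Dof B = D)).card :=
        card_eq_sum_card_fiberwise (fun B hB => mem_image_of_mem _ hB)
    _ ≤ ∑ _D ∈ BD, 4 := sum_le_sum hfib
    _ ≤ ∑ D ∈ BD, ∑ S ∈ tgt D, sl S := by
        apply sum_le_sum
        intro D hD
        obtain ⟨B₁, hB₁, rfl⟩ := mem_image.1 hD
        rw [sum_pair (hdistinct B₁ hB₁)]
        have h0 := hslack B₁ hB₁ _ (hout B₁ hB₁).1
        have h1 := hslack B₁ hB₁ _ (hout B₁ hB₁).2.1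
        omega
    _ = ∑ S ∈ BD.biUnion tgt, sl S := by rw [sum_biUnion hdisj]
    _ ≤ ∑ S ∈ levelSetCoQ N t 3, sl S := by
        apply sum_le_sum_of_subset_of_nonneg
        · intro S hS
          rw [mem_biUnion] at hS
          obtain ⟨D, hD, hS⟩ := hS
          obtain ⟨B₁, hB₁, rfl⟩ := mem_image.1 hD
          rcases mem_insert.1 hS with h | h
          · rw [h]; exact hT B₁ hB₁ _ (hout B₁ hB₁).1
          · rw [mem_singleton.1 h]; exact hT B₁ hB₁ _ (hout B₁ hB₁).2.1
        · intro _ _ _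
          exact Nat.zero_le _

/-- **`thresholdSum` at co-rank `3` through the long-line bound**. -/
theorem thresholdSum_three_le_add_card_bad_long (hcf : ∀ z ∈ gr N, rk N ((gr N).erase z) = rk N (gr N))
    (hR : 3 ≤ rk N (gr N)) (t : ℕ) :
    ∑ B ∈ (Rq N 2).filter (fun B => t + 1 ≤ rk N (gr N \ B)), rk N (gr N \ B) ≤
      ∑ B ∈ (Rq N 2).filter (fun B => t + 1 ≤ rk N (gr N \ B)), (gr N \ clF N B).card +
        (((Rq N 2).filter (fun B => t + 1 ≤ rk N (gr N \ B))).filter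
          (fun B => (clF N B).card + rk N (gr N) = (gr N).card + 1 ∧ B ≠ clF N B)).card := by
  rw [card_filter, ← sum_add_distrib]
  apply sum_le_sum
  intro B hB
  exact rk_sdiff_le_card_sdiff_clF_add_ite_long hcf hR (mem_filter.1 hB).1

/-- **THE LONG-LINE CASE**: on a simple coloop-free matroid with `ρ(E) ≥ 3` and `ν(E) ≥ 3`, `ThresholdIneq N 3 t`
for every `t` (through the excess form). -/
theorem thresholdIneq_three_of_long (hpair : ∀ x ∈ gr N, ∀ y ∈ gr N, x ≠ y → rk N {x, y} = 2)
    (hcf : ∀ z ∈ gr N, rk N ((gr N).erase z) = rk N (gr N)) (hR : 3 ≤ rk N (gr N))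
    (hnu : rk N (gr N) + 3 ≤ (gr N).card) (t : ℕ) : ThresholdIneq N 3 t := by
  rw [thresholdIneq_iff_excess (by norm_num)]
  simp only [Nat.reduceSub]
  have h1 := thresholdSum_three_le_add_card_bad_long hcf hR t
  have h2 := card_bad_long_le (t := t) hpair hcf hR hnu
  omega

end Count

end PercRepro.Cogirth
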